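import Mathlib.Analysis.Calculus.MeanValue
import Mathlib.MeasureTheory.Integral.IntervalIntegral.Basic
import Mathlib.MeasureTheory.Measure.Lebesgue.EqHaar
import Mathlib.MeasureTheory.Measure.Lebesgue.VolumeOfBalls
import Literature.Analysis.FluidPDE.AncientSimilarityVariables
import Literature.Analysis.FluidPDE.PineauVicolGaussSobolev

/-!
# Crux `SymmetricScarExists` (stmt-NavierStokesRegularity-11718), line `logtime-bernoulli-certificate`: STUB 5

The registered stub `stub_smallDefectSlice` of the line's skeleton: for a smooth backward-Leray
profile `U(s, y)` (Leray's backward similarity variables, all `s ∈ ℝ`) with the scale-invariant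
weighted bounds, FINITE GAUSSIAN ACTION

  `∃ A, ∀ s₁ ≤ s₂, ∫_{s₁}^{s₂} F ≤ A`,  `F(σ) = ∫ ‖∂ₛU(σ, y)‖² g(y) dy`,  `g = e^{−|y|²/4}`,

together with the weighted Lipschitz bound `(1 + |y|)² |∇∂ₛU| ≤ K` yields, for every `δ > 0` and
`R > 0`, ONE slice `s̄` on which the self-similar defect is small on the big ball:
`‖∂ₛU(s̄, y)‖ ≤ δ` for all `‖y‖ < R`.

Proof (folklore; Chebyshev in `s` + Lipschitz-to-sup on a ball).  The field `∂ₛU = timeDerivWithin univ U`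
is jointly smooth (`IsSmoothSpaceTimeOn.timeDerivWithin`), so each slice `z ↦ ∂ₛU(σ, z)` is
`K`-Lipschitz (mean value theorem) and bounded by `K`, and `F` is continuous (dominated
convergence, dominating function `K² g`).  If a slice `σ` has a point `y₀ ∈ B_R` with
`‖∂ₛU(σ, y₀)‖ > δ`, then `‖∂ₛU(σ, ·)‖ ≥ δ/2` on the ball `B(y₀, ρ)`, `ρ = min 1 (δ / (2(K+1)))`,
which lies in `B(0, R + 1)` where `g ≥ e^{−(R+1)²/4}`; hence `F(σ) ≥ c₀ > 0` with `c₀`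
independent of `σ`.  But `∫₀ⁿ F ≤ A` for all `n` and `F` continuous force `F(σ) < c₀` for some `σ`.
Helper file for the crux item (lands `--supports stmt-NavierStokesRegularity-11718`).
-/

noncomputable section

open MeasureTheory Set Function Filter Metric
open scoped ContDiff Topology

namespace Summit.NavierStokesRegularity.NavierStokesRegularity.Theorems.SymmetricScarExists.LogtimeBernoulli

open Literature.Analysis.FluidPDE Literature.Analysis.FluidPDE.PineauVicol2026

/-- Lipschitz-to-sup on a ball: if `V` is `K`-Lipschitz and `‖V y₀‖ > δ`, then `‖V‖ ≥ δ/2` on the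
ball `B(y₀, min 1 (δ/(2(K+1))))`. [folklore] -/
theorem half_le_norm_of_lipschitz_of_mem_ball {V : EuclideanSpace ℝ (Fin 3) → EuclideanSpace ℝ (Fin 3)}
    {K δ : ℝ} (hK : 0 ≤ K) (hδ : 0 < δ) (hlip : ∀ x y, ‖V x - V y‖ ≤ K * ‖x - y‖)
    {y₀ z : EuclideanSpace ℝ (Fin 3)} (hy₀ : δ < ‖V y₀‖)
    (hz : z ∈ ball y₀ (min 1 (δ / (2 * (K + 1))))) : δ / 2 ≤ ‖V z‖ := by
  rw [mem_ball, dist_eq_norm, ← norm_neg, neg_sub] at hz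
  have h1 : ‖y₀ - z‖ < δ / (2 * (K + 1)) := lt_of_lt_of_le hz (min_le_right _ _)
  have h2 : K * ‖y₀ - z‖ ≤ K * (δ / (2 * (K + 1))) := mul_le_mul_of_nonneg_left h1.le hK
  have h3 : K * (δ / (2 * (K + 1))) ≤ δ / 2 := by
    rw [← sub_nonneg]
    have hK1 : (0 : ℝ) < K + 1 := by linarith
    have : δ / 2 - K * (δ / (2 * (K + 1))) = δ / (2 * (K + 1)) := by
      field_simp
      ring
    rw [this]
    positivity
  have h4 : ‖V y₀‖ - ‖V z‖ ≤ ‖V y₀ - V z‖ := norm_sub_norm_le _ _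
  have h5 := hlip y₀ z
  linarith

/-- On the ball `B(0, R + 1)` the Gaussian weight is at least `e^{−(R+1)²/4}`. [folklore] -/
theorem exp_le_gaussWeight_of_norm_le {R : ℝ} {z : EuclideanSpace ℝ (Fin 3)}
    (hz : ‖z‖ ≤ R + 1) : Real.exp (-(R + 1) ^ 2 / 4) ≤ gaussWeight z := by
  unfold gaussWeight
  apply Real.exp_le_exp.2
  have : ‖z‖ ^ 2 ≤ (R + 1) ^ 2 := pow_le_pow_left₀ (norm_nonneg _) hz 2
  linarith

/-- The Gaussian action density `‖V‖² g` of a field bounded by `K` is integrable (dominated by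
`K² g`). [folklore] -/
theorem integrable_norm_sq_mul_gaussWeight_of_bound
    {V : EuclideanSpace ℝ (Fin 3) → EuclideanSpace ℝ (Fin 3)} {K : ℝ} (hcont : Continuous V)
    (hbd : ∀ y, ‖V y‖ ≤ K) : Integrable (fun y => ‖V y‖ ^ 2 * gaussWeight y) := by
  refine (integrable_gaussWeight.const_mul (K ^ 2)).mono'
    ((hcont.norm.pow 2).mul continuous_gaussWeight).aestronglyMeasurable
    (Eventually.of_forall fun y => ?_)
  rw [Real.norm_of_nonneg (mul_nonneg (sq_nonneg _) (gaussWeight_pos y).le)]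
  exact mul_le_mul_of_nonneg_right (pow_le_pow_left₀ (norm_nonneg _) (hbd y) 2)
    (gaussWeight_pos y).le

/-- **One bad point costs a fixed amount of Gaussian action.** If `V` is continuous, bounded by
`K` and `K`-Lipschitz, and `‖V y₀‖ > δ` at some `y₀ ∈ B_R`, then
`∫ ‖V‖² g ≥ (δ/2)² e^{−(R+1)²/4} |B_ρ|`, `ρ = min 1 (δ/(2(K+1)))`. [folklore] -/
theorem const_le_integral_norm_sq_mul_gaussWeight
    {V : EuclideanSpace ℝ (Fin 3) → EuclideanSpace ℝ (Fin 3)} {K δ R : ℝ} (hK : 0 ≤ K)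
    (hδ : 0 < δ) (hcont : Continuous V) (hbd : ∀ y, ‖V y‖ ≤ K)
    (hlip : ∀ x y, ‖V x - V y‖ ≤ K * ‖x - y‖) {y₀ : EuclideanSpace ℝ (Fin 3)} (hy₀R : ‖y₀‖ < R)
    (hy₀ : δ < ‖V y₀‖) :
    (δ / 2) ^ 2 * Real.exp (-(R + 1) ^ 2 / 4) *
        (volume (ball (0 : EuclideanSpace ℝ (Fin 3)) (min 1 (δ / (2 * (K + 1)))))).toReal ≤
      ∫ y, ‖V y‖ ^ 2 * gaussWeight y := by
  set ρ : ℝ := min 1 (δ / (2 * (K + 1))) with hρ_def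
  have hint := integrable_norm_sq_mul_gaussWeight_of_bound hcont hbd
  -- pointwise lower bound on the ball
  have hpt : ∀ z ∈ ball y₀ ρ,
      (δ / 2) ^ 2 * Real.exp (-(R + 1) ^ 2 / 4) ≤ ‖V z‖ ^ 2 * gaussWeight z := by
    intro z hz
    have h1 : δ / 2 ≤ ‖V z‖ := half_le_norm_of_lipschitz_of_mem_ball hK hδ hlip hy₀ hz
    have h2 : ‖z‖ ≤ R + 1 := by
      rw [mem_ball, dist_eq_norm] at hz
      have h3 : ‖z‖ ≤ ‖z - y₀‖ + ‖y₀‖ := norm_le_norm_sub_add z y₀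
      have h4 : ρ ≤ 1 := min_le_left _ _
      linarith
    exact mul_le_mul (pow_le_pow_left₀ (by positivity) h1 2)
      (exp_le_gaussWeight_of_norm_le h2) (Real.exp_pos _).le (sq_nonneg _)
  calc (δ / 2) ^ 2 * Real.exp (-(R + 1) ^ 2 / 4) *
        (volume (ball (0 : EuclideanSpace ℝ (Fin 3)) ρ)).toReal
      = ∫ _ in ball y₀ ρ, (δ / 2) ^ 2 * Real.exp (-(R + 1) ^ 2 / 4) := by
        rw [setIntegral_const, measureReal_def, Measure.addHaar_ball_center volume y₀ ρ, smul_eq_mul,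
          mul_comm]
    _ ≤ ∫ y in ball y₀ ρ, ‖V y‖ ^ 2 * gaussWeight y :=
        setIntegral_mono_on (integrableOn_const measure_ball_lt_top.ne) hint.integrableOn
          measurableSet_ball hpt
    _ ≤ ∫ y, ‖V y‖ ^ 2 * gaussWeight y :=
        setIntegral_le_integral hint (Eventually.of_forall fun y =>
          mul_nonneg (sq_nonneg _) (gaussWeight_pos y).le)

/-- **The Gaussian action density is continuous in time** for a jointly continuous field bounded
by `K` (dominated convergence, dominating function `K² g`). [folklore] -/
theorem continuous_integral_norm_sq_mul_gaussWeight
    {V : ℝ → EuclideanSpace ℝ (Fin 3) → EuclideanSpace ℝ (Fin 3)} {K : ℝ}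
    (hcont : Continuous (uncurry V)) (hbd : ∀ s y, ‖V s y‖ ≤ K) :
    Continuous fun s => ∫ y, ‖V s y‖ ^ 2 * gaussWeight y := by
  have hs : ∀ s, Continuous fun y => V s y := fun s =>
    hcont.comp (continuous_const.prodMk continuous_id)
  have hy : ∀ y, Continuous fun s => V s y := fun y =>
    hcont.comp (continuous_id.prodMk continuous_const)
  refine continuous_of_dominated (bound := fun y => K ^ 2 * gaussWeight y)
    (fun s => (((hs s).norm.pow 2).mul continuous_gaussWeight).aestronglyMeasurable)
    (fun s => Eventually.of_forall fun y => ?_) (integrable_gaussWeight.const_mul (K ^ 2))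
    (Eventually.of_forall fun y => ((hy y).norm.pow 2).mul continuous_const)
  rw [Real.norm_of_nonneg (mul_nonneg (sq_nonneg _) (gaussWeight_pos y).le)]
  exact mul_le_mul_of_nonneg_right (pow_le_pow_left₀ (norm_nonneg _) (hbd s y) 2)
    (gaussWeight_pos y).le

/-- **Chebyshev in time.** A continuous function whose interval integrals are uniformly bounded,
`∫_{s₁}^{s₂} F ≤ A` for all `s₁ ≤ s₂`, takes a value below any `c₀ > 0`. [folklore] -/
theorem exists_lt_of_intervalIntegral_le {F : ℝ → ℝ} (hF : Continuous F) {A c₀ : ℝ}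
    (hc₀ : 0 < c₀) (hA : ∀ s₁ s₂ : ℝ, s₁ ≤ s₂ → (∫ σ in s₁..s₂, F σ) ≤ A) : ∃ σ, F σ < c₀ := by
  by_contra h
  push Not at h
  obtain ⟨n, hn⟩ := exists_nat_gt (A / c₀)
  have hn0 : (0 : ℝ) ≤ n := Nat.cast_nonneg n
  have h1 : (∫ _ in (0 : ℝ)..n, c₀) ≤ ∫ σ in (0 : ℝ)..n, F σ :=
    intervalIntegral.integral_mono_on hn0 (continuous_const.intervalIntegrable _ _)
      (hF.intervalIntegrable _ _) fun x _ => h x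
  rw [intervalIntegral.integral_const, smul_eq_mul, sub_zero] at h1
  have h2 := hA 0 n hn0
  have h3 : A < n * c₀ := (div_lt_iff₀ hc₀).1 hn
  linarith

/-- **STUB 5 of line `logtime-bernoulli-certificate`** (M): finite Gaussian action + the weighted
Lipschitz bound on `∂ₛU` ⇒ for every `δ, R > 0` some slice `s̄` has `‖∂ₛU(s̄, y)‖ ≤ δ` on `B_R`
(Chebyshev in `s` + Lipschitz-to-sup on the ball; `F(s) = ∫‖∂ₛU(s)‖²g` is continuous and
`∫_{s₁}^{s₂} F ≤ A`). [folklore] -/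
theorem stub_smallDefectSlice :
    ∀ (C K : ℝ) (U : ℝ → EuclideanSpace ℝ (Fin 3) → EuclideanSpace ℝ (Fin 3)) (P : ℝ → EuclideanSpace ℝ (Fin 3) → ℝ), (Literature.Analysis.FluidPDE.IsBackwardLeraySolutionOn (Set.univ : Set ℝ) 1 U P ∧ ∀ (s : ℝ) (y : EuclideanSpace ℝ (Fin 3)), (1 + ‖y‖) * ‖U s y‖ ≤ C ∧ (1 + ‖y‖) ^ 2 * ‖fderiv ℝ (U s) y‖ ≤ K ∧ (1 + ‖y‖) ^ 3 * ‖iteratedFDeriv ℝ 2 (U s) y‖ ≤ K ∧ (1 + ‖y‖) ^ 2 * |P s y| ≤ K ∧ (1 + ‖y‖) ^ 3 * ‖gradient (P s) y‖ ≤ K ∧ (1 + ‖y‖) * ‖Literature.Analysis.FluidPDE.timeDerivWithin (Set.univ : Set ℝ) U s y‖ ≤ K ∧ (1 + ‖y‖) ^ 2 * ‖fderiv ℝ (fun z => Literature.Analysis.FluidPDE.timeDerivWithin (Set.univ : Set ℝ) U s z) y‖ ≤ K ∧ (1 + ‖y‖) ^ 3 * ‖Literature.Analysis.FluidPDE.timeDerivWithin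 (Set.univ : Set ℝ) U s y + (1 / 2 : ℝ) • U s y + (1 / 2 : ℝ) • fderiv ℝ (U s) y y‖ ≤ K) → (∃ A : ℝ, ∀ s₁ s₂ : ℝ, s₁ ≤ s₂ → (∫ σ in s₁..s₂, (∫ y : EuclideanSpace ℝ (Fin 3), ‖Literature.Analysis.FluidPDE.timeDerivWithin (Set.univ : Set ℝ) U σ y‖ ^ 2 * Literature.Analysis.FluidPDE.PineauVicol2026.gaussWeight y)) ≤ A) → ∀ δ : ℝ, 0 < δ → ∀ R : ℝ, 0 < R → (∃ sbar : ℝ, ∀ y : EuclideanSpace ℝ (Fin 3), ‖y‖ < R → ‖Literature.Analysis.FluidPDE.timeDerivWithin (Set.univ : Set ℝ) U sbar y‖ ≤ δ) := by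
  intro C K U P hLB hA δ hδ R hR
  obtain ⟨hsol, hb⟩ := hLB
  obtain ⟨A, hA⟩ := hA
  -- the self-similar defect `∂ₛU` is jointly smooth
  have hV : IsSmoothSpaceTimeOn (univ : Set ℝ) (timeDerivWithin (univ : Set ℝ) U) :=
    hsol.smooth_velocity.timeDerivWithin uniqueDiffOn_univ
  have hc : Continuous (uncurry (timeDerivWithin (univ : Set ℝ) U)) := by
    have := hV.continuousOn
    rwa [univ_prod_univ, continuousOn_univ] at this
  have hdiff : ∀ s, Differentiable ℝ (timeDerivWithin (univ : Set ℝ) U s) := fun s =>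
    (hV.contDiff_slice (mem_univ s)).differentiable (by simp)
  -- the constant `K` is nonnegative and bounds `∂ₛU` and `∇∂ₛU`
  have hK : 0 ≤ K :=
    le_trans (mul_nonneg (by positivity) (norm_nonneg _)) (hb 0 0).2.2.2.2.2.1
  have hbd : ∀ s y, ‖timeDerivWithin (univ : Set ℝ) U s y‖ ≤ K := fun s y =>
    le_trans (le_mul_of_one_le_left (norm_nonneg _) (by linarith [norm_nonneg y]))
      (hb s y).2.2.2.2.2.1
  have hfd : ∀ s y, ‖fderiv ℝ (timeDerivWithin (univ : Set ℝ) U s) y‖ ≤ K := fun s y =>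
    le_trans (le_mul_of_one_le_left (norm_nonneg _)
      (one_le_pow₀ (by linarith [norm_nonneg y]))) (hb s y).2.2.2.2.2.2.1
  have hlip : ∀ s x y, ‖timeDerivWithin (univ : Set ℝ) U s x - timeDerivWithin (univ : Set ℝ) U s y‖
      ≤ K * ‖x - y‖ := fun s x y =>
    convex_univ.norm_image_sub_le_of_norm_fderiv_le (fun z _ => hdiff s z)
      (fun z _ => hfd s z) (mem_univ y) (mem_univ x)
  -- the action density is continuous in `s`, hence dips below the cost `c₀` of one bad point
  have hFc := continuous_integral_norm_sq_mul_gaussWeight hc hbd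
  have hρ : 0 < min 1 (δ / (2 * (K + 1))) := lt_min one_pos (by positivity)
  have hc₀ : 0 < (δ / 2) ^ 2 * Real.exp (-(R + 1) ^ 2 / 4) *
      (volume (ball (0 : EuclideanSpace ℝ (Fin 3)) (min 1 (δ / (2 * (K + 1)))))).toReal :=
    mul_pos (mul_pos (by positivity) (Real.exp_pos _))
      (ENNReal.toReal_pos (measure_ball_pos volume _ hρ).ne' measure_ball_lt_top.ne)
  obtain ⟨σ, hσ⟩ := exists_lt_of_intervalIntegral_le hFc hc₀ hA
  refine ⟨σ, fun y hy => ?_⟩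
  by_contra hlt
  push Not at hlt
  exact absurd (const_le_integral_norm_sq_mul_gaussWeight hK hδ
    (hc.comp (continuous_const.prodMk continuous_id)) (hbd σ) (hlip σ) hy hlt) (not_le.2 hσ)

end Summit.NavierStokesRegularity.NavierStokesRegularity.Theorems.SymmetricScarExists.LogtimeBernoulli
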